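import Mathlib
import Summits.Ventures.PercRepro2.A3CutFMoTerms

/-!
# The explored vertex is a cut vertex with the mark `o` behind it: (MEANS-a₃) is an exact zero and
(FM) is the BHK inequality
(blind cell PercRepro2, night-1 g33; proofs/NIGHT1-G33.md §6; census: mining/night-1/g33/check_opp.py,
check_opp2.py — 551/551 and 368/368)

Setting of A3CutFMoFibres: `x` a cut vertex (`IsCut ends x ↑VA ↑VB EA EB`), the mark `o ∈ VA` behind it,
the roots `a₁, a₂ ∈ VB ∪ {x}`; the mark `b` is arbitrary.  On every fibre of the `x`-exploration
`F⁰ = σ_o + σ₃(γ − U_o)` is `σ₃ γ` (`SFg0_x_eq`) and `U_o` vanishes on the `A`-fibres (`SuA_o_x_oA`), so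
`D_o = 0`, `γ = 0`, and **`btw(x) = 0`** (`btw_cut_oBehind`).  The first-order functional is
`FMfun(x) = 2 γ₀ · [(P(T′) P(Q, b ∈ C₂) + P(T) P(Q, b ∈ C₁)) / P(Q) − P(T′, b ∈ C₂) − P(T, b ∈ C₁)]`
(`FMfun_cut_oBehind_eq`), and the bracket is nonnegative by BHK06 Thm 1.4 on `Q` twice
(`bhk_cross_cluster`: `P(Q, x ∈ C₁, b ∈ C₂) P(Q) ≤ P(Q, x ∈ C₁) P(Q, b ∈ C₂)` and its mirror), so
**`FM_cut_oBehind`**; hence (MEANS-a₃), (FM), (HCOV) at `x` (`A3Between_cut_oBehind`,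
`HCov_cut_oBehind`) — and by A3CutExpand's `A3Between_cut_of` at every vertex of every other mark-free
part hanging at `x`.  Standard axioms.
-/

namespace Summit.Ventures.PercRepro2

open UnionCluster CovForm CutV

namespace CovForm

namespace A3Fibre

namespace CutOBehind

section OBehind

variable {V : Type*} {E : Type*} [Fintype V] [DecidableEq V] [Fintype E] [DecidableEq E]
  {R : Type*} [Field R] [LinearOrder R] [IsStrictOrderedRing R] {ends : E → Sym2 V} {x : V}
  {VA VB : Finset V} {EA EB : Set E} [DecidablePred (· ∈ EA)] [DecidablePred (· ∈ EB)] {p : E → R}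
  {o a₁ a₂ b : V}

/-! ## The four sums -/

omit [DecidablePred (· ∈ EB)] in
/-- `∑_W Sb · SFg(γ) / m_W = γ · ∑_W s3 · Sb`. -/
lemma sum_term_oA (hp : IsProbVec p) (h : IsCut ends x ↑VA ↑VB EA EB) (ho : o ∈ VA)
    (h1 : a₁ ∈ insert x VB) (h2 : a₂ ∈ insert x VB) (γ : R) :
    ∑ W : Finset V, Ssig p ends a₁ a₂ x b W * RootEdge.SFg p ends o a₁ a₂ x γ W /
        mW p ends a₁ a₂ x W =
      γ * ∑ W : Finset V, s3 a₁ a₂ W * Ssig p ends a₁ a₂ x b W := by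
  rw [Finset.mul_sum]
  refine Finset.sum_congr rfl fun W _ => ?_
  rw [term_x_oA hp h ho h1 h2 γ W]
  ring

omit [LinearOrder R] [IsStrictOrderedRing R] [DecidablePred (· ∈ EB)] in
/-- `∑_W SFg(γ) = γ · ∑_W s3 · m_W`. -/
lemma sum_SFg_oA (h : IsCut ends x ↑VA ↑VB EA EB) (ho : o ∈ VA) (h1 : a₁ ∈ insert x VB)
    (h2 : a₂ ∈ insert x VB) (γ : R) :
    ∑ W : Finset V, RootEdge.SFg p ends o a₁ a₂ x γ W =
      γ * ∑ W : Finset V, s3 a₁ a₂ W * mW p ends a₁ a₂ x W := by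
  rw [Finset.mul_sum]
  refine Finset.sum_congr rfl fun W _ => ?_
  rw [SFg0_x_eq h ho h1 h2]
  ring

omit [LinearOrder R] [IsStrictOrderedRing R] [DecidablePred (· ∈ EB)] in
/-- `∑_{W ∈ A} Su_o W = 0`. -/
lemma sum_SuA_o_oA (h : IsCut ends x ↑VA ↑VB EA EB) (ho : o ∈ VA) (h1 : a₁ ∈ insert x VB)
    (h2 : a₂ ∈ insert x VB) : ∑ W ∈ fibresA a₁ a₂, Su p ends a₁ a₂ x o W = 0 := by
  rw [fibresA, Finset.sum_filter]
  exact Finset.sum_eq_zero fun W _ => SuA_o_x_oA h ho h1 h2 W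

omit [LinearOrder R] [IsStrictOrderedRing R] [DecidablePred (· ∈ EB)] in
/-- `∑_{W ∈ A} Su_b · Su_o / m_W = 0`. -/
lemma sum_termA_oA (h : IsCut ends x ↑VA ↑VB EA EB) (ho : o ∈ VA) (h1 : a₁ ∈ insert x VB)
    (h2 : a₂ ∈ insert x VB) :
    ∑ W ∈ fibresA a₁ a₂, Su p ends a₁ a₂ x b W * Su p ends a₁ a₂ x o W / mW p ends a₁ a₂ x W =
      0 := by
  refine Finset.sum_eq_zero fun W hW => ?_
  rw [fibresA, Finset.mem_filter] at hW
  rw [Su_o_x_eq h ho h1 h2, s3_eq_zero_of_notMem hW.2.1 hW.2.2]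
  simp

/-! ## (MEANS-a₃) is an exact zero -/

omit [DecidablePred (· ∈ EB)] in
/-- **`btw(x) = 0` when the mark `o` lies behind the explored cut vertex `x`** (any `b`). -/
theorem btw_cut_oBehind (hp : IsProbVec p) (h : IsCut ends x ↑VA ↑VB EA EB) (ho : o ∈ VA)
    (h1 : a₁ ∈ insert x VB) (h2 : a₂ ∈ insert x VB) : btw p ends o a₁ a₂ x b = 0 := by
  have hγ : gamma p ends o a₁ a₂ x = 0 := by
    unfold gamma
    rw [Do_eq_fibresA, sum_SuA_o_oA h ho h1 h2, zero_div]
  rw [← RootEdge.btwg_gamma]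
  unfold RootEdge.btwg
  rw [sum_term_oA hp h ho h1 h2, sum_SFg_oA h ho h1 h2, sum_termA_oA h ho h1 h2,
    sum_SuA_o_oA h ho h1 h2, hγ]
  simp

omit [DecidablePred (· ∈ EB)] in
/-- (MEANS-a₃) at `x` with `o` behind it. -/
theorem A3Between_cut_oBehind (hp : IsProbVec p) (h : IsCut ends x ↑VA ↑VB EA EB) (ho : o ∈ VA)
    (h1 : a₁ ∈ insert x VB) (h2 : a₂ ∈ insert x VB) : A3Between p ends o a₁ a₂ x b := by
  unfold A3Between
  rw [btw_cut_oBehind hp h ho h1 h2]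

omit [DecidablePred (· ∈ EB)] in
/-- (HCOV) at `x` with `o` behind it. -/
theorem HCov_cut_oBehind (hp : IsProbVec p) (h : IsCut ends x ↑VA ↑VB EA EB) (ho : o ∈ VA)
    (h1 : a₁ ∈ insert x VB) (h2 : a₂ ∈ insert x VB) : HCov p ends o a₁ a₂ x b :=
  HCov_of_a3Between hp ends o a₁ a₂ x b (A3Between_cut_oBehind hp h ho h1 h2)

/-! ## (FM) is the BHK inequality -/

omit [DecidablePred (· ∈ EA)] [DecidablePred (· ∈ EB)] in
/-- At `P(Q) = 0` the first-order functional vanishes: every fibre mass is null. -/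
lemma FMfun_eq_zero_of_Q_eq_zero' (hp : IsProbVec p) (o x b : V)
    (hQ : prob p (avoidAll ends a₂ {a₁}) = 0) : FMfun p ends o a₁ a₂ x b = 0 := by
  have hm : ∀ W, mW p ends a₁ a₂ x W = 0 := fun W => by
    have key := prob_mono hp (Set.inter_subset_left : fibre ends a₁ a₂ x W ⊆ avoidAll ends a₂ {a₁})
    rw [hQ] at key
    exact le_antisymm key (prob_nonneg hp _)
  have hs : ∀ y W, Ssig p ends a₁ a₂ x y W = 0 :=
    fun y W => Ssig_eq_zero_of_mW_eq_zero hp ends a₁ a₂ x y W (hm W)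
  have hu : ∀ y W, Su p ends a₁ a₂ x y W = 0 :=
    fun y W => Su_eq_zero_of_mW_eq_zero hp ends a₁ a₂ x y W (hm W)
  unfold FMfun
  simp [hs, hu, hm, hQ]

omit [DecidablePred (· ∈ EB)] in
/-- **`FMfun(x)` with `o` behind `x`**: the cleared form in the four joint probabilities. -/
theorem FMfun_cut_oBehind_eq (hp : IsProbVec p) (h : IsCut ends x ↑VA ↑VB EA EB) (ho : o ∈ VA)
    (h1 : a₁ ∈ insert x VB) (h2 : a₂ ∈ insert x VB) :
    FMfun p ends o a₁ a₂ x b =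
      gamma0 p ends o a₁ a₂ * (2 *
        ((prob p (TEvent ends a₂ a₁ x) * prob p (avoidAll ends a₂ {a₁} ∩ connEvent ends a₂ b) +
            prob p (TEvent ends a₁ a₂ x) * prob p (avoidAll ends a₂ {a₁} ∩ connEvent ends a₁ b)) /
          prob p (avoidAll ends a₂ {a₁}) -
          (prob p (TEvent ends a₂ a₁ x ∩ connEvent ends a₂ b) +
            prob p (TEvent ends a₁ a₂ x ∩ connEvent ends a₁ b)))) := by
  by_cases hQ : prob p (avoidAll ends a₂ {a₁}) = 0
  · rw [FMfun_eq_zero_of_Q_eq_zero' hp o x b hQ]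
    unfold gamma0
    rw [hQ, div_zero, zero_mul]
  have hD : prob p (PDEvent ends a₁ a₂ x) =
      prob p (avoidAll ends a₂ {a₁}) - prob p (TEvent ends a₁ a₂ x) -
        prob p (TEvent ends a₂ a₁ x) := by
    have key := Qsplit_univ p ends a₁ a₂ x
    linarith
  have hb1 : prob p (PDEvent ends a₁ a₂ x ∩ connEvent ends a₁ b) =
      prob p (avoidAll ends a₂ {a₁} ∩ connEvent ends a₁ b) -
        prob p (TEvent ends a₁ a₂ x ∩ connEvent ends a₁ b) -
        prob p (TEvent ends a₂ a₁ x ∩ connEvent ends a₁ b) := by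
    have key := Qsplit p ends a₁ a₂ x (connEvent ends a₁ b)
    linarith
  have hb2 : prob p (PDEvent ends a₁ a₂ x ∩ connEvent ends a₂ b) =
      prob p (avoidAll ends a₂ {a₁} ∩ connEvent ends a₂ b) -
        prob p (TEvent ends a₁ a₂ x ∩ connEvent ends a₂ b) -
        prob p (TEvent ends a₂ a₁ x ∩ connEvent ends a₂ b) := by
    have key := Qsplit p ends a₁ a₂ x (connEvent ends a₂ b)
    linarith
  unfold FMfun
  rw [sum_term_oA hp h ho h1 h2, sum_SFg_oA h ho h1 h2, sum_termA_oA h ho h1 h2,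
    sum_SuA_o_oA h ho h1 h2, ← EQb3_eq, ← EQ3_eq, ← EQo_eq p ends b a₁ a₂ x,
    ← Do_eq_fibresA p ends b a₁ a₂ x]
  unfold gamma0 EQb3 EQ3 EQo Do LeafStep.mU
  rw [hD, hb1, hb2]
  field_simp
  ring

omit [Fintype V] [DecidableEq V] [Fintype E] [DecidableEq E] [DecidablePred (· ∈ EA)]
  [DecidablePred (· ∈ EB)] in
/-- `{s ↔ u}` as a cluster event. -/
lemma connEvent_eq_clusterInEvent_mem (ends : E → Sym2 V) (s u : V) :
    connEvent ends s u = clusterInEvent ends s {W : Set V | u ∈ W} := by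
  ext ω
  simp only [mem_connEvent, mem_clusterInEvent, Set.mem_setOf_eq, mem_cluster]

omit [DecidablePred (· ∈ EA)] [DecidablePred (· ∈ EB)] in
/-- **BHK on `Q`**: `P(Q, s ↔ u, t ↔ w) · P(Q) ≤ P(Q, s ↔ u) · P(Q, t ↔ w)` for the roots `s ≠ t`
(the up-sets `{W | u ∈ W}`, `{W | w ∈ W}` in `bhk_cross_cluster`). -/
lemma bhk_conn_conn (hp : IsProbVec p) (ends : E → Sym2 V) (s t u w : V) :
    prob p ((connEvent ends s t)ᶜ ∩ connEvent ends s u ∩ connEvent ends t w) *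
        prob p (connEvent ends s t)ᶜ ≤
      prob p ((connEvent ends s t)ᶜ ∩ connEvent ends s u) *
        prob p ((connEvent ends s t)ᶜ ∩ connEvent ends t w) := by
  have key := bhk_cross_cluster p hp ends s t (𝓤 := {W : Set V | u ∈ W}) (𝓥 := {W : Set V | w ∈ W})
    (fun _ _ hWW' hu => hWW' hu) (fun _ _ hWW' hw => hWW' hw)
  rw [← connEvent_eq_clusterInEvent_mem, ← connEvent_eq_clusterInEvent_mem] at key
  have e1 : connEvent ends s u ∩ connEvent ends t w ∩ (connEvent ends s t)ᶜ =
      (connEvent ends s t)ᶜ ∩ connEvent ends s u ∩ connEvent ends t w := by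
    ext ω; simp only [Set.mem_inter_iff]; tauto
  have e2 : connEvent ends s u ∩ (connEvent ends s t)ᶜ = (connEvent ends s t)ᶜ ∩ connEvent ends s u :=
    Set.inter_comm _ _
  have e3 : connEvent ends t w ∩ (connEvent ends s t)ᶜ = (connEvent ends s t)ᶜ ∩ connEvent ends t w :=
    Set.inter_comm _ _
  rwa [e1, e2, e3] at key

omit [DecidablePred (· ∈ EA)] [DecidablePred (· ∈ EB)] in
/-- `P(T′, b ∈ C₂) · P(Q) ≤ P(T′) · P(Q, b ∈ C₂)`. -/
lemma bhk_Tp (hp : IsProbVec p) (ends : E → Sym2 V) (a₁ a₂ x b : V) :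
    prob p (TEvent ends a₂ a₁ x ∩ connEvent ends a₂ b) * prob p (avoidAll ends a₂ {a₁}) ≤
      prob p (TEvent ends a₂ a₁ x) * prob p (avoidAll ends a₂ {a₁} ∩ connEvent ends a₂ b) := by
  have key := bhk_conn_conn hp ends a₁ a₂ x b
  rw [← avoidAll_eq_compl' ends a₁ a₂] at key
  unfold TEvent
  rw [← avoidAll_eq_compl' ends a₁ a₂]
  exact key

omit [DecidablePred (· ∈ EA)] [DecidablePred (· ∈ EB)] in
/-- `P(T, b ∈ C₁) · P(Q) ≤ P(T) · P(Q, b ∈ C₁)`. -/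
lemma bhk_T (hp : IsProbVec p) (ends : E → Sym2 V) (a₁ a₂ x b : V) :
    prob p (TEvent ends a₁ a₂ x ∩ connEvent ends a₁ b) * prob p (avoidAll ends a₂ {a₁}) ≤
      prob p (TEvent ends a₁ a₂ x) * prob p (avoidAll ends a₂ {a₁} ∩ connEvent ends a₁ b) := by
  have key := bhk_conn_conn hp ends a₂ a₁ x b
  rw [← avoidAll_eq_compl ends a₁ a₂] at key
  unfold TEvent
  rw [← avoidAll_eq_compl ends a₁ a₂]
  exact key

omit [DecidablePred (· ∈ EB)] in
/-- **(FM) at `x` with `o` behind it** — BHK06 Thm 1.4 twice. -/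
theorem FM_cut_oBehind (hp : IsProbVec p) (h : IsCut ends x ↑VA ↑VB EA EB) (ho : o ∈ VA)
    (h1 : a₁ ∈ insert x VB) (h2 : a₂ ∈ insert x VB) : FM p ends o a₁ a₂ x b := by
  unfold FM
  rw [FMfun_cut_oBehind_eq hp h ho h1 h2]
  refine mul_nonneg ?_ (mul_nonneg (by norm_num) ?_)
  · unfold gamma0 LeafStep.mU
    exact div_nonneg (add_nonneg (prob_nonneg hp _) (prob_nonneg hp _)) (prob_nonneg hp _)
  · rw [sub_nonneg]
    rcases (prob_nonneg hp (avoidAll ends a₂ {a₁})).lt_or_eq with hQ | hQ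
    · rw [le_div_iff₀ hQ, add_mul]
      exact add_le_add (bhk_Tp hp ends a₁ a₂ x b) (bhk_T hp ends a₁ a₂ x b)
    · rw [← hQ, div_zero]
      have hz : ∀ A : Set (Config E), A ⊆ avoidAll ends a₂ {a₁} → prob p A = 0 := fun A hA => by
        have key := prob_mono hp hA
        rw [← hQ] at key
        exact le_antisymm key (prob_nonneg hp _)
      rw [hz _ ?_, hz _ ?_, add_zero]
      · intro ω hω
        rw [avoidAll_eq_compl]
        exact hω.1.1
      · intro ω hω
        rw [avoidAll_eq_compl']
        exact hω.1.1

end OBehind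

end CutOBehind

end A3Fibre

end CovForm

end Summit.Ventures.PercRepro2
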